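import Summits.QuantumFields.YangMills.Theorems.AllWindowsColdBoxBoxHighLineOrbitJacobianDefs
import Mathlib.Analysis.Calculus.MeanValue
import Mathlib.Topology.MetricSpace.Contracting

/-!
# T-S5.4J brick J4 `OrbitMapBulkSurj` — the Newton–contraction engine and the conditional brick `orbitMapBulkSurj_of`
# (LINE-19 S5 ⟨stmt-QuantumFields-24004⟩/⟨24335⟩, LINE-20 U5 ⟨24336⟩; task `Cruxes/BoxWindowHighSU2213/TaskS5Laplace.lean`, planner ym-idea-2 g18;
# Props from ✓`…OrbitJacobianDefs` BY NAME)

Width seat `ym-line-sfw-p2-w4` (prover-ym-line-sfw-p2-w4-g27-0), owner of J4.  Surjectivity of the orbit map `Ψ_V = orbitMapFlat H V` from the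
sup-box `{∀ x, ‖(♭⁻¹v)_x‖ ≤ a}` onto the ℓ²-ball `{|c|₂ ≤ ρ}`, by the Banach fixed point of `T_c(v) = v − F_V⁻¹(Ψ_V(v) − c)`.

Everything is done on the flat coordinate space `ι → ℝ` with Mathlib's SUP norm (so `fderiv` is native; no `EuclideanSpace` transport):
* **engine** (`OrbitMapSurj.*`, Mathlib only): the sup-Lipschitz bound of `T_c` on a convex set from `HasFDerivAt Ψ (Ψ' v) v` and the J2-shaped
  ℓ² bound `‖w − F⁻¹(Ψ' v w)‖₂ ≤ K₂‖w‖₂` (`lipschitzOnWith_newton`, constant `K₂·√|ι|` via `norm_le_sqrt_dotProduct` / `sqrt_dotProduct_le`), and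
  the fixed point ⇒ solution step on a closed invariant set (`exists_apply_eq_of_lipschitzOnWith`, Mathlib `ContractingWith.exists_fixedPoint'`);
* **the block box** `{v | ∀ x, ‖vecToField H v x‖ ≤ a}` is closed and convex, contains `0`, controls the sup norm, and each block is
  `≤ √3·‖·‖_∞`; rows of `F⁻¹` control the blocks of `F⁻¹c` by Cauchy–Schwarz (`norm_vecToField_mulVec_le`);
* `orbitMapFlat_zero` — `Ψ_V(0) = 0` for `V` in lattice Landau gauge;
* **`orbitMapBulkSurj_of`** — `OrbitMapBulkSurj` from J1 (`OrbitMapJacobianDet`, only its differentiability clause is used), J2 (`OrbitMapContraction`)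
  and a ROW bound for `F_V⁻¹` (`∃ C_r > 0, … Σ_t ((fpOperator H V)⁻¹ p t)² ≤ C_r (1 + log H)⁴`, = LEAD's ✓`inv_row_sq_le_four_mul` + ✓4i-a
  `dirichletGreenRowSqSum` + w2's 4c-E, assembled in the companion file), all three taken as HYPOTHESES (planner's convention for late bricks).
  Constants: sup-contraction `K = 7·C_J2·H⁴·a ≤ 1/4` from `C·H⁴·a ≤ 1`; self-map `√3·K·a + √3·√C_r·(1+log H)²·ρ ≤ a` from `C·(1+log H)²·ρ ≤ a`.

Everything proved; no definitions; standard axioms.  HONEST LABEL: a CONDITIONAL brick (hypotheses J1, J2, row bound) of step (1b)/(1c) of the XL stubs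
S5/U5 of critic-PASSed DRAFT lines on the R2ξ″ cruxes; T-S5.4J, S5, U5 and the items ⟨24004⟩ ⟨24335⟩ ⟨24336⟩ remain OPEN; no stub is closed by name,
no crux, rung or summit is proved; the Yang–Mills mass gap is NOT proved by this file.
-/

set_option autoImplicit false

open Matrix Finset Set
open scoped NNReal
open Literature.MathematicalPhysics.QuantumFieldTheory.AxialGauge (boxEdges)
open Literature.MathematicalPhysics.QuantumLattice (gaugeTransformZd LGConfig)
open Literature.Probability.LatticeModels (Site)

namespace Summit.QuantumFields.YangMills.Theorems.AllWindowsColdBoxBoxHighLine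

namespace OrbitMapSurj

/-! ## 1. Sup norm versus dot product on `ι → ℝ` -/

section Norms

variable {ι : Type*} [Fintype ι]

/-- A coordinate squared is at most `w ⬝ᵥ w`. -/
theorem sq_apply_le_dotProduct (w : ι → ℝ) (i : ι) : w i ^ 2 ≤ w ⬝ᵥ w := by
  classical
  have h : w i * w i ≤ ∑ j, w j * w j := by
    rw [← Finset.add_sum_erase Finset.univ _ (Finset.mem_univ i)]
    exact le_add_of_nonneg_right (Finset.sum_nonneg fun j _ => mul_self_nonneg (w j))
  simpa only [dotProduct, sq] using h

/-- `‖w‖_∞ ≤ |w|₂`. -/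
theorem norm_le_sqrt_dotProduct (w : ι → ℝ) : ‖w‖ ≤ Real.sqrt (w ⬝ᵥ w) := by
  refine (pi_norm_le_iff_of_nonneg (Real.sqrt_nonneg _)).2 fun i => ?_
  rw [Real.norm_eq_abs, ← Real.sqrt_sq_eq_abs]
  exact Real.sqrt_le_sqrt (sq_apply_le_dotProduct w i)

/-- `|w|₂² ≤ |ι|·‖w‖_∞²`. -/
theorem dotProduct_self_le_card_mul_sq_norm (w : ι → ℝ) : w ⬝ᵥ w ≤ Fintype.card ι * ‖w‖ ^ 2 := by
  calc w ⬝ᵥ w = ∑ i, w i ^ 2 := by simp only [dotProduct, sq]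
    _ ≤ ∑ _i : ι, ‖w‖ ^ 2 := Finset.sum_le_sum fun i _ => by
        have h := norm_le_pi_norm w i
        rw [Real.norm_eq_abs] at h
        rw [← sq_abs]
        exact pow_le_pow_left₀ (abs_nonneg _) h 2
    _ = Fintype.card ι * ‖w‖ ^ 2 := by rw [Finset.sum_const, Finset.card_univ, nsmul_eq_mul]

/-- `|w|₂ ≤ √|ι|·‖w‖_∞`. -/
theorem sqrt_dotProduct_le (w : ι → ℝ) : Real.sqrt (w ⬝ᵥ w) ≤ Real.sqrt (Fintype.card ι) * ‖w‖ := by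
  calc Real.sqrt (w ⬝ᵥ w) ≤ Real.sqrt (Fintype.card ι * ‖w‖ ^ 2) := Real.sqrt_le_sqrt (dotProduct_self_le_card_mul_sq_norm w)
    _ = Real.sqrt (Fintype.card ι) * ‖w‖ := by rw [Real.sqrt_mul (Nat.cast_nonneg _), Real.sqrt_sq (norm_nonneg _)]

/-- **ℓ² operator bound ⇒ sup operator bound**: `|u|₂² ≤ K₂²|w|₂²` gives `‖u‖_∞ ≤ K₂·√|ι|·‖w‖_∞`. -/
theorem norm_le_of_dotProduct_le {u w : ι → ℝ} {K₂ : ℝ} (hK₂ : 0 ≤ K₂) (h : u ⬝ᵥ u ≤ K₂ ^ 2 * (w ⬝ᵥ w)) :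
    ‖u‖ ≤ K₂ * Real.sqrt (Fintype.card ι) * ‖w‖ := by
  have hw : 0 ≤ w ⬝ᵥ w := Finset.sum_nonneg fun i _ => mul_self_nonneg (w i)
  calc ‖u‖ ≤ Real.sqrt (u ⬝ᵥ u) := norm_le_sqrt_dotProduct u
    _ ≤ Real.sqrt (K₂ ^ 2 * (w ⬝ᵥ w)) := Real.sqrt_le_sqrt h
    _ = K₂ * Real.sqrt (w ⬝ᵥ w) := by rw [Real.sqrt_mul' _ hw, Real.sqrt_sq hK₂]
    _ ≤ K₂ * (Real.sqrt (Fintype.card ι) * ‖w‖) := mul_le_mul_of_nonneg_left (sqrt_dotProduct_le w) hK₂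
    _ = K₂ * Real.sqrt (Fintype.card ι) * ‖w‖ := by ring

/-- **Row Cauchy–Schwarz**: `((G c) p)² ≤ (Σ_t G p t²)·|c|₂²`. -/
theorem mulVec_apply_sq_le (G : Matrix ι ι ℝ) (c : ι → ℝ) (p : ι) :
    (G *ᵥ c) p ^ 2 ≤ (∑ t, G p t ^ 2) * (c ⬝ᵥ c) := by
  have h := Finset.sum_mul_sq_le_sq_mul_sq Finset.univ (fun t => G p t) c
  simpa only [mulVec, dotProduct, sq] using h

end Norms

/-! ## 2. The Newton–contraction engine on `ι → ℝ` -/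

section Engine

variable {ι : Type*} [Fintype ι] [DecidableEq ι]

/-- **Sup-Lipschitz bound of the Newton map** `T_c v = v − G(Ψ v − c)` on a convex set `S`: from `HasFDerivAt Ψ (Ψ' v) v` on `S` and the ℓ² bound
`|w − G(Ψ' v w)|₂² ≤ K₂²|w|₂²` (the shape of J2 `OrbitMapContraction`), `T_c` is `K₂·√|ι|`-Lipschitz on `S` in the sup norm (mean value inequality). -/
theorem lipschitzOnWith_newton (Ψ : (ι → ℝ) → (ι → ℝ)) (Ψ' : (ι → ℝ) → ((ι → ℝ) →L[ℝ] (ι → ℝ))) (G : Matrix ι ι ℝ)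
    (S : Set (ι → ℝ)) (hSconv : Convex ℝ S) (hdiff : ∀ v ∈ S, HasFDerivAt Ψ (Ψ' v) v)
    {K₂ : ℝ} (hK₂ : 0 ≤ K₂) (hcontr : ∀ v ∈ S, ∀ w, (w - G *ᵥ (Ψ' v w)) ⬝ᵥ (w - G *ᵥ (Ψ' v w)) ≤ K₂ ^ 2 * (w ⬝ᵥ w))
    (K : ℝ≥0) (hK : K₂ * Real.sqrt (Fintype.card ι) ≤ K) (c : ι → ℝ) :
    LipschitzOnWith K (fun v => v - G *ᵥ (Ψ v - c)) S := by
  set Gop : (ι → ℝ) →L[ℝ] (ι → ℝ) := LinearMap.toContinuousLinearMap (Matrix.toLin' G) with hGop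
  have hGop_apply : ∀ w, Gop w = G *ᵥ w := fun w => by
    rw [hGop, LinearMap.coe_toContinuousLinearMap', Matrix.toLin'_apply]
  -- the derivative of `T_c` within `S`
  have hT : ∀ v ∈ S, HasFDerivWithinAt (fun v => v - G *ᵥ (Ψ v - c))
      (ContinuousLinearMap.id ℝ (ι → ℝ) - Gop.comp (Ψ' v)) S v := by
    intro v hv
    have h1 : HasFDerivAt (fun v => Ψ v - c) (Ψ' v) v := (hdiff v hv).sub_const c
    have h2 : HasFDerivAt (fun v => Gop (Ψ v - c)) (Gop.comp (Ψ' v)) v := Gop.hasFDerivAt.comp v h1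
    have h3 : HasFDerivAt (fun v => G *ᵥ (Ψ v - c)) (Gop.comp (Ψ' v)) v := by
      refine h2.congr_of_eventuallyEq (Filter.Eventually.of_forall fun w => ?_)
      simp only [hGop_apply]
    exact ((hasFDerivAt_id v).sub h3).hasFDerivWithinAt
  -- its operator norm
  have hbound : ∀ v ∈ S, ‖ContinuousLinearMap.id ℝ (ι → ℝ) - Gop.comp (Ψ' v)‖₊ ≤ K := by
    intro v hv
    have hKnn : 0 ≤ K₂ * Real.sqrt (Fintype.card ι) := mul_nonneg hK₂ (Real.sqrt_nonneg _)
    have h : ‖ContinuousLinearMap.id ℝ (ι → ℝ) - Gop.comp (Ψ' v)‖ ≤ K₂ * Real.sqrt (Fintype.card ι) := by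
      refine ContinuousLinearMap.opNorm_le_bound _ hKnn fun w => ?_
      have hw : (ContinuousLinearMap.id ℝ (ι → ℝ) - Gop.comp (Ψ' v)) w = w - G *ᵥ (Ψ' v w) := by
        simp only [_root_.sub_apply, ContinuousLinearMap.id_apply, ContinuousLinearMap.comp_apply, hGop_apply]
      rw [hw]
      exact norm_le_of_dotProduct_le hK₂ (hcontr v hv w)
    exact_mod_cast h.trans hK
  exact hSconv.lipschitzOnWith_of_nnnorm_hasFDerivWithin_le hT hbound

/-- **Fixed point ⇒ solution**: if `T_c v = v − F⁻¹(Ψ v − c)` maps a closed set `S ∋ v₀` into itself and is `K`-Lipschitz there with `K < 1`, and `F` is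
invertible, then `Ψ v = c` for some `v ∈ S` (Banach on the complete subspace `S`). -/
theorem exists_apply_eq_of_lipschitzOnWith (Ψ : (ι → ℝ) → (ι → ℝ)) (F : Matrix ι ι ℝ) (hF : IsUnit F.det)
    (S : Set (ι → ℝ)) (hSc : IsClosed S) {v₀ : ι → ℝ} (hv₀ : v₀ ∈ S) (c : ι → ℝ) {K : ℝ≥0} (hK : K < 1)
    (hLip : LipschitzOnWith K (fun v => v - F⁻¹ *ᵥ (Ψ v - c)) S)
    (hmaps : MapsTo (fun v => v - F⁻¹ *ᵥ (Ψ v - c)) S S) :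
    ∃ v ∈ S, Ψ v = c := by
  obtain ⟨y, hyS, hfix, -⟩ :=
    ContractingWith.exists_fixedPoint' hSc.isComplete hmaps ⟨hK, hLip.mapsToRestrict hmaps⟩ hv₀ (edist_ne_top _ _)
  refine ⟨y, hyS, ?_⟩
  have h0 : F⁻¹ *ᵥ (Ψ y - c) = 0 := by
    have h : y - F⁻¹ *ᵥ (Ψ y - c) = y := hfix.eq
    exact sub_eq_self.1 h
  have h1 : Ψ y - c = F *ᵥ (F⁻¹ *ᵥ (Ψ y - c)) := by
    rw [Matrix.mulVec_mulVec, Matrix.mul_nonsing_inv F hF, Matrix.one_mulVec]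
  rw [h0, Matrix.mulVec_zero] at h1
  exact sub_eq_zero.1 h1

end Engine

/-! ## 3. The block box `{v | ∀ x, ‖vecToField H v x‖ ≤ a}` -/

section Box

variable {H : ℕ}

/-- Reading the `x`-block is continuous. -/
theorem continuous_vecToField_apply (x : ↥(interiorSites H)) :
    Continuous fun v : ↥(interiorSites H) × Fin 3 → ℝ => vecToField H v x := by
  have h : Continuous fun v : ↥(interiorSites H) × Fin 3 → ℝ => fun b : Fin 3 => v (x, b) :=
    continuous_pi fun b => continuous_apply (x, b)
  exact (PiLp.continuous_toLp 2 _).comp h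

/-- The block box is closed. -/
theorem isClosed_blockBox (a : ℝ) :
    IsClosed {v : ↥(interiorSites H) × Fin 3 → ℝ | ∀ x, ‖vecToField H v x‖ ≤ a} := by
  have h : {v : ↥(interiorSites H) × Fin 3 → ℝ | ∀ x, ‖vecToField H v x‖ ≤ a} =
      ⋂ x, {v | ‖vecToField H v x‖ ≤ a} := by
    ext v; simp
  rw [h]
  exact isClosed_iInter fun x => isClosed_le ((continuous_vecToField_apply x).norm) continuous_const

/-- The block box is convex. -/
theorem convex_blockBox (a : ℝ) :
    Convex ℝ {v : ↥(interiorSites H) × Fin 3 → ℝ | ∀ x, ‖vecToField H v x‖ ≤ a} := by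
  intro v hv w hw s t hs ht hst x
  rw [vecToField_add, vecToField_smul, vecToField_smul, Pi.add_apply, Pi.smul_apply, Pi.smul_apply]
  calc ‖s • vecToField H v x + t • vecToField H w x‖ ≤ ‖s • vecToField H v x‖ + ‖t • vecToField H w x‖ := norm_add_le _ _
    _ = s * ‖vecToField H v x‖ + t * ‖vecToField H w x‖ := by
        rw [norm_smul, norm_smul, Real.norm_of_nonneg hs, Real.norm_of_nonneg ht]
    _ ≤ s * a + t * a := add_le_add (mul_le_mul_of_nonneg_left (hv x) hs) (mul_le_mul_of_nonneg_left (hw x) ht)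
    _ = a := by rw [← add_mul, hst, one_mul]

/-- `0` lies in the block box (`a ≥ 0`). -/
theorem zero_mem_blockBox {a : ℝ} (ha : 0 ≤ a) :
    (0 : ↥(interiorSites H) × Fin 3 → ℝ) ∈ {v : ↥(interiorSites H) × Fin 3 → ℝ | ∀ x, ‖vecToField H v x‖ ≤ a} := by
  intro x
  have : vecToField H (0 : ↥(interiorSites H) × Fin 3 → ℝ) x = 0 := by ext b; rfl
  rw [this, norm_zero]
  exact ha

/-- A coordinate is at most its block's norm. -/
theorem abs_apply_le_norm_vecToField (v : ↥(interiorSites H) × Fin 3 → ℝ) (x : ↥(interiorSites H)) (b : Fin 3) :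
    |v (x, b)| ≤ ‖vecToField H v x‖ := by
  rw [EuclideanSpace.norm_eq, ← Real.sqrt_sq_eq_abs]
  refine Real.sqrt_le_sqrt ?_
  have h : ‖(vecToField H v x).ofLp b‖ ^ 2 ≤ ∑ i, ‖(vecToField H v x).ofLp i‖ ^ 2 := by
    classical
    rw [← Finset.add_sum_erase Finset.univ _ (Finset.mem_univ b)]
    exact le_add_of_nonneg_right (Finset.sum_nonneg fun i _ => sq_nonneg _)
  have hb : (vecToField H v x).ofLp b = v (x, b) := rfl
  rw [hb, Real.norm_eq_abs, sq_abs] at h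
  exact h

/-- In the block box the sup norm is at most `a`. -/
theorem norm_le_of_mem_blockBox {a : ℝ} (ha : 0 ≤ a) {v : ↥(interiorSites H) × Fin 3 → ℝ} (hv : ∀ x, ‖vecToField H v x‖ ≤ a) :
    ‖v‖ ≤ a := by
  refine (pi_norm_le_iff_of_nonneg ha).2 fun p => ?_
  rw [Real.norm_eq_abs]
  obtain ⟨x, b⟩ := p
  exact (abs_apply_le_norm_vecToField v x b).trans (hv x)

/-- A block is at most `√3` times the sup norm. -/
theorem norm_vecToField_le (v : ↥(interiorSites H) × Fin 3 → ℝ) (x : ↥(interiorSites H)) :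
    ‖vecToField H v x‖ ≤ Real.sqrt 3 * ‖v‖ := by
  rw [EuclideanSpace.norm_eq]
  have h : ∑ i : Fin 3, ‖(vecToField H v x).ofLp i‖ ^ 2 ≤ 3 * ‖v‖ ^ 2 := by
    calc ∑ i : Fin 3, ‖(vecToField H v x).ofLp i‖ ^ 2 ≤ ∑ _i : Fin 3, ‖v‖ ^ 2 := Finset.sum_le_sum fun i _ => by
          have hi : (vecToField H v x).ofLp i = v (x, i) := rfl
          rw [hi]
          exact pow_le_pow_left₀ (norm_nonneg _) (norm_le_pi_norm v (x, i)) 2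
      _ = 3 * ‖v‖ ^ 2 := by simp
  calc Real.sqrt (∑ i : Fin 3, ‖(vecToField H v x).ofLp i‖ ^ 2) ≤ Real.sqrt (3 * ‖v‖ ^ 2) := Real.sqrt_le_sqrt h
    _ = Real.sqrt 3 * ‖v‖ := by rw [Real.sqrt_mul (by norm_num), Real.sqrt_sq (norm_nonneg _)]

/-- **Rows of `G` control the blocks of `G c`**: if every row of `G` has `Σ_t G p t² ≤ R²` then `‖(G c)_x‖ ≤ √3 · R · |c|₂`. -/
theorem norm_vecToField_mulVec_le (G : Matrix (↥(interiorSites H) × Fin 3) (↥(interiorSites H) × Fin 3) ℝ)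
    {R ρ : ℝ} (hR : 0 ≤ R) (hρ : 0 ≤ ρ) (hrow : ∀ p, ∑ t, G p t ^ 2 ≤ R ^ 2)
    (c : ↥(interiorSites H) × Fin 3 → ℝ) (hc : c ⬝ᵥ c ≤ ρ ^ 2) (x : ↥(interiorSites H)) :
    ‖vecToField H (G *ᵥ c) x‖ ≤ Real.sqrt 3 * R * ρ := by
  rw [EuclideanSpace.norm_eq]
  have hcc : 0 ≤ c ⬝ᵥ c := Finset.sum_nonneg fun i _ => mul_self_nonneg (c i)
  have h : ∑ i : Fin 3, ‖(vecToField H (G *ᵥ c) x).ofLp i‖ ^ 2 ≤ 3 * (R * ρ) ^ 2 := by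
    calc ∑ i : Fin 3, ‖(vecToField H (G *ᵥ c) x).ofLp i‖ ^ 2 ≤ ∑ _i : Fin 3, (R * ρ) ^ 2 := Finset.sum_le_sum fun i _ => by
          have hi : (vecToField H (G *ᵥ c) x).ofLp i = (G *ᵥ c) (x, i) := rfl
          rw [hi, Real.norm_eq_abs, sq_abs]
          calc (G *ᵥ c) (x, i) ^ 2 ≤ (∑ t, G (x, i) t ^ 2) * (c ⬝ᵥ c) := mulVec_apply_sq_le G c (x, i)
            _ ≤ R ^ 2 * ρ ^ 2 := mul_le_mul (hrow (x, i)) hc hcc (sq_nonneg _)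
            _ = (R * ρ) ^ 2 := by ring
      _ = 3 * (R * ρ) ^ 2 := by simp
  calc Real.sqrt (∑ i : Fin 3, ‖(vecToField H (G *ᵥ c) x).ofLp i‖ ^ 2) ≤ Real.sqrt (3 * (R * ρ) ^ 2) := Real.sqrt_le_sqrt h
    _ = Real.sqrt 3 * R * ρ := by rw [Real.sqrt_mul (by norm_num), Real.sqrt_sq (mul_nonneg hR hρ), mul_assoc]

/-- `|ι| = 3·#interiorSites H ≤ 48·H⁴`, hence `√|ι| ≤ 7H²`. -/
theorem sqrt_card_le (H : ℕ) : Real.sqrt (Fintype.card (↥(interiorSites H) × Fin 3)) ≤ 7 * (H : ℝ) ^ 2 := by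
  have hcard : (Fintype.card (↥(interiorSites H) × Fin 3) : ℝ) ≤ 48 * (H : ℝ) ^ 4 := by
    rw [Fintype.card_prod, Fintype.card_coe, Fintype.card_fin, interiorSites, Fintype.card_piFinset]
    simp only [Finset.prod_const, Finset.card_univ, Fintype.card_fin, Int.card_Icc]
    have h1 : ((2 * (H : ℤ) - 1 + 1 - 1).toNat : ℝ) ≤ 2 * H := by
      have : (2 * (H : ℤ) - 1 + 1 - 1).toNat ≤ 2 * H := by omega
      exact_mod_cast this
    have h0 : (0 : ℝ) ≤ ((2 * (H : ℤ) - 1 + 1 - 1).toNat : ℝ) := Nat.cast_nonneg _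
    push_cast
    nlinarith [pow_le_pow_left₀ h0 h1 4]
  calc Real.sqrt (Fintype.card (↥(interiorSites H) × Fin 3)) ≤ Real.sqrt (48 * (H : ℝ) ^ 4) := Real.sqrt_le_sqrt hcard
    _ ≤ Real.sqrt ((7 * (H : ℝ) ^ 2) ^ 2) := Real.sqrt_le_sqrt (by nlinarith [sq_nonneg ((H : ℝ) ^ 2)])
    _ = 7 * (H : ℝ) ^ 2 := Real.sqrt_sq (by positivity)

/-- **`Ψ_V(0) = 0` in Landau gauge**: the Pauli gauge of the zero field is the identity and `divDefect V` vanishes at interior sites. -/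
theorem orbitMapFlat_zero (V : LGConfig 4 SU2) (hV : InLandauGauge H V) : orbitMapFlat H V 0 = 0 := by
  have hg : pauliGauge H (vecToField H (0 : ↥(interiorSites H) × Fin 3 → ℝ)) = 1 := by
    funext z
    have h0 : vecToField H (0 : ↥(interiorSites H) × Fin 3 → ℝ) = 0 := by funext y; ext b; rfl
    rw [h0, pauliGauge, extendGauge]
    split_ifs
    · simp [Literature.MathematicalPhysics.QuantumFieldTheory.Balaban1983to89.B10Eq18SigmaSU2Haar.expPauli_zero]
    · rfl
  have h1V : gaugeTransformZd (1 : Site 4 → SU2) V = V := by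
    funext e; simp [gaugeTransformZd]
  funext p
  rw [orbitMapFlat, hg, h1V, Pi.zero_apply]
  have h := (landau_at_iff_divDefect_eq_zero V (p.1 : Site 4)).1 (hV p.1 p.1.2)
  rw [h, Pi.zero_apply]

end Box

end OrbitMapSurj

/-! ## 4. J4 from J1, J2 and a row bound for `F_V⁻¹` -/

open OrbitMapSurj in
/-- **J4 `OrbitMapBulkSurj`, conditional form.**  Assuming J1 `OrbitMapJacobianDet` (only `DifferentiableAt` is used), J2 `OrbitMapContraction`, and a row
bound `Σ_t ((fpOperator H V)⁻¹ p t)² ≤ C_r·(1 + log H)⁴` for base points with links within `r₀²`, `C_r·r₀·H² ≤ 1`: every `c` with `|c|₂ ≤ ρ` is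
`Ψ_V(v)` for some `v` in the `a`-block box, in the regime `C·(r₀ + a)·H² ≤ 1`, `C·H⁴·a ≤ 1`, `C·(1 + log H)²·ρ ≤ a`. -/
theorem orbitMapBulkSurj_of (hJ1 : OrbitMapJacobianDet) (hJ2 : OrbitMapContraction)
    (hrow : ∃ C_r : ℝ, 0 < C_r ∧ ∀ H : ℕ, 1 ≤ H → ∀ r₀ : ℝ, 0 ≤ r₀ → C_r * r₀ * (H : ℝ) ^ 2 ≤ 1 →
      ∀ V : LGConfig 4 SU2, (∀ e ∈ boxEdges 4 (2 * H + 1), linkDefect V e ≤ r₀ ^ 2) →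
        ∀ p : ↥(interiorSites H) × Fin 3, ∑ t, ((fpOperator H V)⁻¹ p t) ^ 2 ≤ C_r * (1 + Real.log H) ^ 4) :
    OrbitMapBulkSurj := by
  obtain ⟨C₂, hC₂, hJ2⟩ := hJ2
  obtain ⟨C_r, hCr, hrow⟩ := hrow
  refine ⟨28 * C₂ + C_r + 8 * (1 + C_r) + 1, by positivity, ?_⟩
  intro H hH r₀ a ρ hr₀ ha hρ h1 h2 h3 V hV hlinks c hc
  have hH' : (1 : ℝ) ≤ H := by exact_mod_cast hH
  have hlog : 0 ≤ Real.log H := Real.log_nonneg hH'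
  set C := 28 * C₂ + C_r + 8 * (1 + C_r) + 1 with hCdef
  have hC2 : C₂ ≤ C := by rw [hCdef]; nlinarith
  have hCr' : C_r ≤ C := by rw [hCdef]; nlinarith
  -- the regime of J2 and of the row bound
  have hH2 : (1 : ℝ) ≤ (H : ℝ) ^ 2 := one_le_pow₀ hH'
  have hH4 : (1 : ℝ) ≤ (H : ℝ) ^ 4 := one_le_pow₀ hH'
  have hr₀J2 : C₂ * r₀ * (H : ℝ) ^ 2 ≤ 1 := by nlinarith [mul_nonneg (mul_nonneg hC₂.le ha) (zero_le_one.trans hH2)]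
  have hr₀r : C_r * r₀ * (H : ℝ) ^ 2 ≤ 1 := by nlinarith [mul_nonneg (mul_nonneg hCr.le ha) (zero_le_one.trans hH2)]
  have ha1 : a ≤ 1 := by nlinarith [mul_nonneg (by positivity : (0 : ℝ) ≤ 28 * C₂ + C_r + 8 * (1 + C_r)) ha]
  obtain ⟨hF, hJ2v⟩ := hJ2 H hH r₀ a hr₀ ha ha1 hr₀J2 V hlinks
  have hrowV := hrow H hH r₀ hr₀ hr₀r V hlinks
  -- the contraction constant in the sup norm
  set K₂ : ℝ := C₂ * (H : ℝ) ^ 2 * a with hK₂def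
  have hK₂ : 0 ≤ K₂ := by positivity
  have hKle : K₂ * Real.sqrt (Fintype.card (↥(interiorSites H) × Fin 3)) ≤ 1 / 4 := by
    calc K₂ * Real.sqrt (Fintype.card (↥(interiorSites H) × Fin 3)) ≤ K₂ * (7 * (H : ℝ) ^ 2) :=
          mul_le_mul_of_nonneg_left (sqrt_card_le H) hK₂
      _ = 7 * C₂ * ((H : ℝ) ^ 4 * a) := by rw [hK₂def]; ring
      _ ≤ 1 / 4 := by nlinarith [mul_nonneg (by positivity : (0 : ℝ) ≤ C_r + 8 * (1 + C_r) + 1) (mul_nonneg (zero_le_one.trans hH4) ha)]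
  set K : ℝ≥0 := 1 / 4 with hKdef
  have hK1 : K < 1 := by rw [hKdef]; norm_num
  -- the set, the map, its Lipschitz bound
  set S : Set (↥(interiorSites H) × Fin 3 → ℝ) := {v | ∀ x, ‖vecToField H v x‖ ≤ a} with hSdef
  have hdiff : ∀ v ∈ S, HasFDerivAt (orbitMapFlat H V) (fderiv ℝ (orbitMapFlat H V) v) v :=
    fun v _ => (hJ1 H V v).1.hasFDerivAt
  have hcontr : ∀ v ∈ S, ∀ w,
      (w - (fpOperator H V)⁻¹ *ᵥ (fderiv ℝ (orbitMapFlat H V) v w)) ⬝ᵥ (w - (fpOperator H V)⁻¹ *ᵥ (fderiv ℝ (orbitMapFlat H V) v w)) ≤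
        K₂ ^ 2 * (w ⬝ᵥ w) :=
    fun v hv w => hJ2v v hv w
  have hLip := lipschitzOnWith_newton (orbitMapFlat H V) (fun v => fderiv ℝ (orbitMapFlat H V) v) ((fpOperator H V)⁻¹) S
    (convex_blockBox a) hdiff hK₂ hcontr K (by rw [hKdef]; exact_mod_cast hKle) c
  -- the self-map
  have h0S : (0 : ↥(interiorSites H) × Fin 3 → ℝ) ∈ S := zero_mem_blockBox ha
  have hΨ0 : orbitMapFlat H V 0 = 0 := orbitMapFlat_zero V hV
  have hR : ∀ p, ∑ t, ((fpOperator H V)⁻¹ p t) ^ 2 ≤ (Real.sqrt C_r * (1 + Real.log H) ^ 2) ^ 2 := by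
    intro p
    rw [mul_pow, Real.sq_sqrt hCr.le, ← pow_mul]
    exact hrowV p
  have hmaps : MapsTo (fun v => v - (fpOperator H V)⁻¹ *ᵥ (orbitMapFlat H V v - c)) S S := by
    intro v hv x
    show ‖vecToField H (v - (fpOperator H V)⁻¹ *ᵥ (orbitMapFlat H V v - c)) x‖ ≤ a
    have hT0 : (0 : ↥(interiorSites H) × Fin 3 → ℝ) - (fpOperator H V)⁻¹ *ᵥ (orbitMapFlat H V 0 - c) = (fpOperator H V)⁻¹ *ᵥ c := by
      rw [hΨ0, zero_sub, zero_sub, Matrix.mulVec_neg, neg_neg]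
    have hdist : ‖(v - (fpOperator H V)⁻¹ *ᵥ (orbitMapFlat H V v - c)) -
        ((0 : ↥(interiorSites H) × Fin 3 → ℝ) - (fpOperator H V)⁻¹ *ᵥ (orbitMapFlat H V 0 - c))‖ ≤ K * ‖v - 0‖ :=
      hLip.norm_sub_le hv h0S
    rw [sub_zero] at hdist
    have hsplit : v - (fpOperator H V)⁻¹ *ᵥ (orbitMapFlat H V v - c) =
        ((v - (fpOperator H V)⁻¹ *ᵥ (orbitMapFlat H V v - c)) -
          ((0 : ↥(interiorSites H) × Fin 3 → ℝ) - (fpOperator H V)⁻¹ *ᵥ (orbitMapFlat H V 0 - c))) + (fpOperator H V)⁻¹ *ᵥ c := by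
      rw [hT0, sub_add_cancel]
    rw [hsplit, vecToField_add, Pi.add_apply]
    have hv' : ‖v‖ ≤ a := norm_le_of_mem_blockBox ha hv
    have hA : ‖vecToField H ((v - (fpOperator H V)⁻¹ *ᵥ (orbitMapFlat H V v - c)) -
        ((0 : ↥(interiorSites H) × Fin 3 → ℝ) - (fpOperator H V)⁻¹ *ᵥ (orbitMapFlat H V 0 - c))) x‖ ≤ Real.sqrt 3 * ((1 / 4) * a) := by
      refine (norm_vecToField_le _ x).trans (mul_le_mul_of_nonneg_left ?_ (Real.sqrt_nonneg _))
      refine hdist.trans ?_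
      rw [hKdef]
      push_cast
      exact mul_le_mul_of_nonneg_left hv' (by norm_num)
    have hB : ‖vecToField H ((fpOperator H V)⁻¹ *ᵥ c) x‖ ≤ Real.sqrt 3 * (Real.sqrt C_r * (1 + Real.log H) ^ 2) * ρ :=
      norm_vecToField_mulVec_le _ (by positivity) hρ hR c hc x
    have hsqrt3 : Real.sqrt 3 ≤ 2 := by
      rw [show (2 : ℝ) = Real.sqrt (2 ^ 2) by rw [Real.sqrt_sq (by norm_num : (0:ℝ) ≤ 2)]]
      exact Real.sqrt_le_sqrt (by norm_num)
    have hsqrtCr : Real.sqrt 3 * Real.sqrt C_r ≤ 1 + C_r := by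
      rw [← Real.sqrt_mul (by norm_num)]
      have h1 : Real.sqrt (3 * C_r) ≤ Real.sqrt ((1 + C_r) ^ 2) := Real.sqrt_le_sqrt (by nlinarith [sq_nonneg (C_r - 1)])
      rwa [Real.sqrt_sq (by positivity)] at h1
    -- `C (1 + log H)² ρ ≤ a` with `C ≥ 8(1 + C_r)`
    have hLρ : 0 ≤ (1 + Real.log H) ^ 2 * ρ := mul_nonneg (sq_nonneg _) hρ
    have h8C : 8 * (1 + C_r) ≤ C := by rw [hCdef]; linarith [hC₂.le, hCr.le]
    have hρa : 8 * (1 + C_r) * (1 + Real.log H) ^ 2 * ρ ≤ a := by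
      calc 8 * (1 + C_r) * (1 + Real.log H) ^ 2 * ρ = (8 * (1 + C_r)) * ((1 + Real.log H) ^ 2 * ρ) := by ring
        _ ≤ C * ((1 + Real.log H) ^ 2 * ρ) := mul_le_mul_of_nonneg_right h8C hLρ
        _ = C * (1 + Real.log H) ^ 2 * ρ := by ring
        _ ≤ a := h3
    have h1 : Real.sqrt 3 * ((1 / 4) * a) ≤ 2 * ((1 / 4) * a) := mul_le_mul_of_nonneg_right hsqrt3 (by positivity)
    have h2 : Real.sqrt 3 * (Real.sqrt C_r * (1 + Real.log H) ^ 2) * ρ ≤ (1 + C_r) * ((1 + Real.log H) ^ 2 * ρ) := by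
      calc Real.sqrt 3 * (Real.sqrt C_r * (1 + Real.log H) ^ 2) * ρ = (Real.sqrt 3 * Real.sqrt C_r) * ((1 + Real.log H) ^ 2 * ρ) := by ring
        _ ≤ (1 + C_r) * ((1 + Real.log H) ^ 2 * ρ) := mul_le_mul_of_nonneg_right hsqrtCr hLρ
    have hsum : Real.sqrt 3 * ((1 / 4) * a) + Real.sqrt 3 * (Real.sqrt C_r * (1 + Real.log H) ^ 2) * ρ ≤ a := by
      have e : (1 + C_r) * ((1 + Real.log H) ^ 2 * ρ) = (8 * (1 + C_r) * (1 + Real.log H) ^ 2 * ρ) / 8 := by ring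
      rw [e] at h2
      linarith
    exact (norm_add_le_of_le hA hB).trans hsum
  -- conclude
  exact exists_apply_eq_of_lipschitzOnWith (orbitMapFlat H V) (fpOperator H V) hF S (isClosed_blockBox a) h0S c hK1 hLip hmaps

end Summit.QuantumFields.YangMills.Theorems.AllWindowsColdBoxBoxHighLine
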